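import Literature.Computability.Complexity.CliqueCounting
import Literature.Computability.Complexity.CliqueRestriction
import Literature.Computability.Complexity.ClosedFamilies
import Literature.Computability.Complexity.ColoringCounting
import HarnessLib

/-!
# Razborov's approximation method for CLIQUE in the Alon–Boppana lattice (Alon–Boppana 1987, §2–§3)

The circuit side of the monotone lower bound for the clique function (`razborov_alon_boppana`,
pnp.S22): Razborov's Theorem (Alon–Boppana 1987, Thm. 2.1, "`L⁺(f) ≥ ρ(f, K)`") run in the
lattice `K(m, r, l)` of closed families of vertex sets (Alon–Boppana 1987, §3.1), together with
the two error estimates and the final dichotomy of Alon–Boppana §3.5 (small cliques, `l = s-1`),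
in the crude form sufficient for `m^{Ω(log m)}`. Everything in this file is PROVED; the
parameters `r, l, s, g` are arbitrary here and are chosen in `CircuitLowerBoundsProofs.lean`.

* `CliquePresent W x`, `Accepts A x` — the monotone function `⌈A⌉` of a family of vertex sets:
  some `W ∈ A` spans a clique of the graph `x` (Alon–Boppana §3.1, "`[A]`").
  On test inputs: `⌈{W}⌉(clique on Z) ↔ W ⊆ Z` (`|W| ≠ 1`) and `⌈{W}⌉(G(O)) ↔ O` injective on `W`.
* `RApprox` — the invariant of the approximator `F_w ∈ K(m, r, l)` of a wire `w` relative to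
  global sets of *lost cliques* `BadZ` and *wrongly accepted colourings* `BadO`
  ((2.1)/(2.2) of Alon–Boppana, restricted to the test inputs): inputs (`inputFamily`), OR gates
  (closure of the union, `RApprox.or_gate`) and AND gates (intersection, `RApprox.and_gate`).
* `card_errPos_le` — an approximate AND loses at most `((r-1)^l)^2` of the `s`-cliques,
  `s = l + 1` (a cruder variant of Alon–Boppana Lemma 3.13, printed bound `2^s (r-1)^s`:
  `|min A| · |min B|` via Cor. 3.3).
* `card_errNeg_mul_le` — an approximate OR wrongly accepts at most
  `|𝒱(l)| · (1 - g(g-1)⋯(g-l+1)/g^l)^r · g^m` colourings (Alon–Boppana Lemma 3.7 with the step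
  count `|𝒱(l)|` of the remark before Lemma 3.4 instead of the printed `2 r^l` of Lemma 3.5,
  via Lemma 3.6 = `card_badColorings_ofFn_mul_le`).
* `exists_rApprox_gates`, `exists_rApprox_circuit` — Theorem 2.1 along a straight-line
  program over `{∧₂, ∨₂}`.
* `razborov_dichotomy` — for a monotone circuit of size `t` computing a function that
  accepts all `s`-cliques and rejects all complete `g`-partite graphs: either
  `g^m · (g^l)^r ≤ t · |𝒱(l)| · (g^l - g(g-1)⋯(g-l+1))^r · g^m` (the approximator is `≡ 1`) or
  `(m choose s) ≤ t · ((r-1)^l)^2 + Σ_{k=2}^{l} (r-1)^k (m-k choose s-k)` (Alon–Boppana, proof of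
  Lemma 3.14, Cases 2 and 1).

## References

* N. Alon, R. B. Boppana, *The monotone circuit complexity of Boolean functions*,
  Combinatorica 7 (1987) 1–22: Thm. 2.1, §3.1 (Lemma 3.1), Cor. 3.3, Lemmas 3.6, 3.7, 3.13, 3.14
  [AlonBoppana1987].
* A. A. Razborov, *Lower bounds on the monotone complexity of some Boolean functions*, Dokl.
  Akad. Nauk SSSR 281 (1985) 798–801 [Razborov1985].
-/

namespace Literature.Computability.Complexity

open Finset GateList Razborov

variable {m : ℕ}

/-- The input positions of `CLIQUE(m, ·)`: the edges of the complete graph `K_m` (as a type).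
[folklore] -/
abbrev KEdge (m : ℕ) : Type := (⊤ : SimpleGraph (Fin m)).edgeSet

/-! ### The monotone function of a family of vertex sets -/

/-- The clique on `W` is present in the graph `x`: every edge inside `W` is on (the *clique
indicator* `⌈W⌉`, Alon–Boppana 1987, §3.1; vacuous for `|W| ≤ 1`). [cite: AlonBoppana1987, §3.1] -/
def CliquePresent (W : Finset (Fin m)) (x : KEdge m → Bool) : Prop :=
  ∀ e : KEdge m, IsLive W e → x e = true

/-- `⌈A⌉(x)`: the graph `x` contains a clique on some member of the family `A` (Alon–Boppana
1987, §3.1, the monotone family `[A]`). [cite: AlonBoppana1987, §3.1] -/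
def Accepts (A : Finset (Finset (Fin m))) (x : KEdge m → Bool) : Prop :=
  ∃ W ∈ A, CliquePresent W x

/-- Smaller vertex sets are easier to find as cliques. [folklore] -/
theorem CliquePresent.anti {W W' : Finset (Fin m)} {x : KEdge m → Bool} (h : CliquePresent W x)
    (hW : W' ⊆ W) : CliquePresent W' x := fun e he => h e (he.mono hW)

/-- The empty clique is always present. [folklore] -/
theorem cliquePresent_empty (x : KEdge m → Bool) : CliquePresent ∅ x := by
  refine edge_ind fun u v _ => ?_
  intro he
  exact absurd (he u (Sym2.mem_mk_left u v)) (notMem_empty u)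

/-- `⌈·⌉` is monotone in the family. [folklore] -/
theorem Accepts.mono {A B : Finset (Finset (Fin m))} {x : KEdge m → Bool} (h : Accepts A x)
    (hAB : A ⊆ B) : Accepts B x := by
  obtain ⟨W, hW, hP⟩ := h
  exact ⟨W, hAB hW, hP⟩

/-- A family containing `∅` accepts every graph. [folklore] -/
theorem accepts_of_empty_mem {A : Finset (Finset (Fin m))} (h : ∅ ∈ A) (x : KEdge m → Bool) :
    Accepts A x := ⟨∅, h, cliquePresent_empty x⟩

/-- The union of two families accepts iff one of them does. [folklore] -/
theorem accepts_union_iff {A B : Finset (Finset (Fin m))} {x : KEdge m → Bool} :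
    Accepts (A ∪ B) x ↔ Accepts A x ∨ Accepts B x := by
  constructor
  · rintro ⟨W, hW, hP⟩
    rcases mem_union.1 hW with hW | hW
    · exact Or.inl ⟨W, hW, hP⟩
    · exact Or.inr ⟨W, hW, hP⟩
  · rintro (h | h)
    · exact h.mono subset_union_left
    · exact h.mono subset_union_right

/-- A clique vector contains its own clique. [folklore] -/
theorem cliquePresent_cliqueVec_self (Z : Finset (Fin m)) : CliquePresent Z (cliqueVec Z) :=
  fun e he => (cliqueVec_eq_true_iff Z e).2 he

/-- **Clique indicators on positive test graphs**: for `|W| ≠ 1`, the clique on `W` is present in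
the clique on `Z` iff `W ⊆ Z` (Alon–Boppana 1987, proof of Lemma 3.8: "each `s`-clique that
belongs to `M` contains some minimal element of `A`"). [cite: AlonBoppana1987, Lemma 3.8] -/
theorem cliquePresent_cliqueVec_iff {W Z : Finset (Fin m)} (hW : #W ≠ 1) :
    CliquePresent W (cliqueVec Z) ↔ W ⊆ Z := by
  constructor
  · intro h u hu
    have h1 : 1 < #W := by
      rcases Nat.lt_or_ge 1 #W with h' | h'
      · exact h'
      · have : #W ≠ 0 := card_ne_zero.2 ⟨u, hu⟩
        omega
    obtain ⟨v, hv, hvu⟩ := exists_mem_ne h1 u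
    have he : s(u, v) ∈ (⊤ : SimpleGraph (Fin m)).edgeSet := (SimpleGraph.mem_edgeSet _).2 hvu.symm
    have hlive : IsLive W ⟨s(u, v), he⟩ := (isLive_mk he).2 ⟨hu, hv⟩
    exact (((isLive_mk he).1 ((cliqueVec_eq_true_iff Z _).1 (h _ hlive)))).1
  · intro h
    exact (cliquePresent_cliqueVec_self Z).anti h

/-- The colouring vector on a concrete edge is on iff the endpoints have different colours.
[folklore] -/
theorem colorVec_mk_eq_true_iff {c : ℕ} (O : Fin m → Fin c) {u v : Fin m}
    (he : s(u, v) ∈ (⊤ : SimpleGraph (Fin m)).edgeSet) :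
    colorVec O ⟨s(u, v), he⟩ = true ↔ O u ≠ O v := by
  simp [colorVec]

/-- **Clique indicators on negative test graphs**: the clique on `W` is present in the complete
multipartite graph of the colouring `O` iff `W` is properly coloured, i.e. `O` is injective on
`W` (Alon–Boppana 1987, proof of Lemma 3.7: "some set in `C*` is PC by `O`"). [cite: AlonBoppana1987, Lemma 3.7] -/
theorem cliquePresent_colorVec_iff {c : ℕ} {W : Finset (Fin m)} {O : Fin m → Fin c} :
    CliquePresent W (colorVec O) ↔ Set.InjOn O ↑W := by
  constructor
  · intro h u hu v hv huv
    by_contra hne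
    have he : s(u, v) ∈ (⊤ : SimpleGraph (Fin m)).edgeSet := (SimpleGraph.mem_edgeSet _).2 hne
    have hlive : IsLive W ⟨s(u, v), he⟩ := (isLive_mk he).2 ⟨hu, hv⟩
    exact (colorVec_mk_eq_true_iff O he).1 (h _ hlive) huv
  · intro h e
    revert e
    refine edge_ind fun u v huv => ?_
    intro hlive
    rw [isLive_mk] at hlive
    rw [colorVec_mk_eq_true_iff]
    exact fun heq => huv (h hlive.1 hlive.2 heq)

/-! ### Approximators of wires -/

/-- The invariant of the approximator `F` (a closed family, i.e. an element of the lattice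
`K(m, r, l)`) of a wire computing `v`, relative to the global sets `BadZ` of lost `s`-cliques
and `BadO` of wrongly accepted `g`-colourings: equations (2.2) and (2.1) of Alon–Boppana (1987,
Thm. 2.1) restricted to the positive and negative test graphs. [cite: AlonBoppana1987, Thm. 2.1] -/
structure RApprox (r l s g : ℕ) (BadZ : Finset (Finset (Fin m))) (BadO : Finset (Fin m → Fin g))
    (F : Finset (Finset (Fin m))) (v : (KEdge m → Bool) → Bool) : Prop where
  /-- the approximator is an element of the lattice -/
  closed : IsClosedFamily r l F
  /-- every accepted `s`-clique is accepted by the approximator or already lost -/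
  pos : ∀ Z : Finset (Fin m), #Z = s → v (cliqueVec Z) = true → Accepts F (cliqueVec Z) ∨ Z ∈ BadZ
  /-- every colouring accepted by the approximator is accepted by the wire or already bad -/
  neg : ∀ O : Fin m → Fin g, Accepts F (colorVec O) → v (colorVec O) = true ∨ O ∈ BadO

/-- The approximator of the input edge `e`: all small vertex sets containing both endpoints of
`e` (the lattice element `A(x_e)`, Alon–Boppana 1987, §2 (ii) and §3.1). [cite: AlonBoppana1987, §3.1] -/
def inputFamily (l : ℕ) (e : KEdge m) : Finset (Finset (Fin m)) :=
  (smallSets (Fin m) l).filter fun W => IsLive W e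

/-- The input approximators are closed (two of the `r ≥ 2` implying sets contain the edge, hence
so does their intersection and the implied set). [cite: AlonBoppana1987, §3.1] -/
theorem isClosedFamily_inputFamily {r : ℕ} (hr : 2 ≤ r) (l : ℕ) :
    ∀ e : KEdge m, IsClosedFamily r l (inputFamily l e) := by
  refine edge_ind fun a b hab => ?_
  set he : s(a, b) ∈ (⊤ : SimpleGraph (Fin m)).edgeSet := (SimpleGraph.mem_edgeSet _).2 hab
  refine ⟨filter_subset _ _, fun U hUl hI => ?_⟩
  obtain ⟨W, hW, hWU⟩ := hI
  set i0 : Fin r := ⟨0, by omega⟩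
  set i1 : Fin r := ⟨1, by omega⟩
  have h0 := (isLive_mk he).1 (mem_filter.1 (hW i0)).2
  have h1 := (isLive_mk he).1 (mem_filter.1 (hW i1)).2
  have hsub := hWU i0 i1 (by simp [i0, i1, Fin.ext_iff])
  have haU : a ∈ U := hsub (mem_inter.2 ⟨h0.1, h1.1⟩)
  have hbU : b ∈ U := hsub (mem_inter.2 ⟨h0.2, h1.2⟩)
  have h2 : 2 ≤ #U := one_lt_card.2 ⟨a, haU, b, hbU, hab⟩
  rw [canon_eq_self h2]
  exact mem_filter.2 ⟨mem_smallSets.2 ⟨hUl, by omega⟩, (isLive_mk he).2 ⟨haU, hbU⟩⟩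

namespace RApprox

variable {r l s g : ℕ} {BadZ BadZ' : Finset (Finset (Fin m))} {BadO BadO' : Finset (Fin m → Fin g)}
  {F F₁ F₂ : Finset (Finset (Fin m))} {v v' u w : (KEdge m → Bool) → Bool}

/-- Enlarging the bad sets preserves the invariant. [folklore] -/
theorem mono (h : RApprox r l s g BadZ BadO F v) (hZ : BadZ ⊆ BadZ') (hO : BadO ⊆ BadO') :
    RApprox r l s g BadZ' BadO' F v where
  closed := h.closed
  pos Z hZs hv := (h.pos Z hZs hv).imp_right fun hb => hZ hb
  neg O hO' := (h.neg O hO').imp_right fun hb => hO hb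

/-- Extensionality in the approximated function. [folklore] -/
theorem congr (h : RApprox r l s g BadZ BadO F v) (hv : ∀ x, v x = v' x) :
    RApprox r l s g BadZ BadO F v' where
  closed := h.closed
  pos Z hZs hvZ := h.pos Z hZs ((hv _).trans hvZ)
  neg O hO := (h.neg O hO).imp_left fun h' => (hv _).symm.trans h'

/-- **Inputs** (Alon–Boppana 1987, Thm. 2.1, case `t = 0`): the input approximator of the edge
`e` makes no error at all (`l ≥ 2` so that the endpoints of `e` form a member).
[cite: AlonBoppana1987, Thm. 2.1] -/
theorem input (hr : 2 ≤ r) (hl : 2 ≤ l) :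
    ∀ e : KEdge m, RApprox r l s g BadZ BadO (inputFamily l e) (fun x => x e) := by
  intro e
  refine ⟨isClosedFamily_inputFamily hr l e, fun Z _ hZ => Or.inl ?_, fun O hO => Or.inl ?_⟩
  · revert hZ
    revert e
    refine edge_ind fun a b hab => ?_
    intro hZ
    set he : s(a, b) ∈ (⊤ : SimpleGraph (Fin m)).edgeSet := (SimpleGraph.mem_edgeSet _).2 hab
    have hlive := (isLive_mk he).1 ((cliqueVec_eq_true_iff Z _).1 hZ)
    have hcard : #({a, b} : Finset (Fin m)) = 2 := card_pair hab
    refine ⟨{a, b}, mem_filter.2 ⟨mem_smallSets.2 ⟨by omega, by omega⟩, (isLive_mk he).2 (by simp)⟩,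
      (cliquePresent_cliqueVec_self Z).anti ?_⟩
    rw [insert_subset_iff, singleton_subset_iff]
    exact hlive
  · obtain ⟨W, hW, hP⟩ := hO
    exact hP e (mem_filter.1 hW).2

end RApprox

/-! ### The error sets of the approximate gates -/

open Classical in
/-- The `s`-cliques lost at an approximate AND gate `⌈A⌉ ∧ ⌈B⌉ ↦ ⌈A ∩ B⌉`
(`δ⊓(M, N)` restricted to `s`-cliques, Alon–Boppana 1987, §2 and Lemma 3.13).
[cite: AlonBoppana1987, Lemma 3.13] -/
noncomputable def errPos (s : ℕ) (A B : Finset (Finset (Fin m))) : Finset (Finset (Fin m)) :=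
  (powersetCard s (univ : Finset (Fin m))).filter fun Z =>
    Accepts A (cliqueVec Z) ∧ Accepts B (cliqueVec Z) ∧ ¬ Accepts (A ∩ B) (cliqueVec Z)

open Classical in
/-- The colourings wrongly accepted when a family `C` is replaced by its closure
(`[C*] - [C]` on the graphs `G(O)`, Alon–Boppana 1987, Lemma 3.7; at an OR gate `C = A ∪ B`
and this is `δ⊔(M, N)` restricted to the negative test graphs). [cite: AlonBoppana1987, Lemma 3.7] -/
noncomputable def errNeg (g r l : ℕ) (C : Finset (Finset (Fin m))) : Finset (Fin m → Fin g) :=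
  univ.filter fun O => Accepts (closure r l C) (colorVec O) ∧ ¬ Accepts C (colorVec O)

/-- Membership in `errPos`. [folklore] -/
theorem mem_errPos {s : ℕ} {A B : Finset (Finset (Fin m))} {Z : Finset (Fin m)} :
    Z ∈ errPos s A B ↔ #Z = s ∧ Accepts A (cliqueVec Z) ∧ Accepts B (cliqueVec Z) ∧
      ¬ Accepts (A ∩ B) (cliqueVec Z) := by
  classical
  simp [errPos, mem_powersetCard]

/-- Membership in `errNeg`. [folklore] -/
theorem mem_errNeg {g r l : ℕ} {C : Finset (Finset (Fin m))} {O : Fin m → Fin g} :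
    O ∈ errNeg g r l C ↔ Accepts (closure r l C) (colorVec O) ∧ ¬ Accepts C (colorVec O) := by
  classical
  simp [errNeg]

namespace RApprox

variable {r l s g : ℕ} {BadZ : Finset (Finset (Fin m))} {BadO : Finset (Fin m → Fin g)}
  {F₁ F₂ : Finset (Finset (Fin m))} {u w : (KEdge m → Bool) → Bool}

/-- **OR gates** (Alon–Boppana 1987, Thm. 2.1, case `f = f_t ∨ g_t`, with the join
`[A] ⊔ [B] = [(A ∪ B)*]` of Lemma 3.1): no new lost cliques; the new wrongly accepted
colourings are `errNeg (F₁ ∪ F₂)`. [cite: AlonBoppana1987, Thm. 2.1] -/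
theorem or_gate (hu : RApprox r l s g BadZ BadO F₁ u) (hw : RApprox r l s g BadZ BadO F₂ w) :
    RApprox r l s g BadZ (BadO ∪ errNeg g r l (F₁ ∪ F₂)) (closure r l (F₁ ∪ F₂))
      (fun x => u x || w x) := by
  have hsub : F₁ ∪ F₂ ⊆ smallSets (Fin m) l := union_subset hu.closed.subset hw.closed.subset
  refine ⟨isClosedFamily_closure r l _, fun Z hZs hZ => ?_, fun O hO => ?_⟩
  · rw [Bool.or_eq_true] at hZ
    rcases hZ with hZ | hZ
    · rcases hu.pos Z hZs hZ with h | h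
      · exact Or.inl ((h.mono subset_union_left).mono (subset_closure hsub))
      · exact Or.inr h
    · rcases hw.pos Z hZs hZ with h | h
      · exact Or.inl ((h.mono subset_union_right).mono (subset_closure hsub))
      · exact Or.inr h
  · by_cases hacc : Accepts (F₁ ∪ F₂) (colorVec O)
    · rcases accepts_union_iff.1 hacc with h | h
      · rcases hu.neg O h with h' | h'
        · left; rw [h']; rfl
        · exact Or.inr (mem_union_left _ h')
      · rcases hw.neg O h with h' | h'
        · left; rw [h', Bool.or_true]
        · exact Or.inr (mem_union_left _ h')
    · exact Or.inr (mem_union_right _ (mem_errNeg.2 ⟨hO, hacc⟩))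

/-- **AND gates** (Alon–Boppana 1987, Thm. 2.1, case `f = f_t ∧ g_t`, with the meet
`[A] ⊓ [B] = [A ∩ B]` of Lemma 3.1): no new wrongly accepted colourings; the new lost cliques
are `errPos s F₁ F₂`. [cite: AlonBoppana1987, Thm. 2.1] -/
theorem and_gate (hu : RApprox r l s g BadZ BadO F₁ u) (hw : RApprox r l s g BadZ BadO F₂ w) :
    RApprox r l s g (BadZ ∪ errPos s F₁ F₂) BadO (F₁ ∩ F₂) (fun x => u x && w x) := by
  refine ⟨hu.closed.inter hw.closed, fun Z hZs hZ => ?_, fun O hO => ?_⟩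
  · rw [Bool.and_eq_true] at hZ
    rcases hu.pos Z hZs hZ.1 with h1 | h1
    · rcases hw.pos Z hZs hZ.2 with h2 | h2
      · by_cases h12 : Accepts (F₁ ∩ F₂) (cliqueVec Z)
        · exact Or.inl h12
        · exact Or.inr (mem_union_right _ (mem_errPos.2 ⟨hZs, h1, h2, h12⟩))
      · exact Or.inr (mem_union_left _ h2)
    · exact Or.inr (mem_union_left _ h1)
  · rcases hu.neg O (hO.mono inter_subset_left) with h1 | h1
    · rcases hw.neg O (hO.mono inter_subset_right) with h2 | h2
      · left; rw [h1, h2]; rfl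
      · exact Or.inr h2
    · exact Or.inr h1

end RApprox

/-! ### Bounding the errors -/

/-- **Lost cliques of an approximate AND** — a cruder variant of Alon–Boppana 1987,
Lemma 3.13 (whose printed bound is `2^s (r-1)^s`; the weaker count below follows from the first
half of its proof and suffices for `m^{Ω(log m)}`): for closed `A, B` and `s = l + 1`, an
`s`-clique `Z` accepted by `⌈A⌉` and `⌈B⌉` but not by `⌈A ∩ B⌉` is `X ∪ Y` for minimal members
`X ∈ A`, `Y ∈ B` (if `|X ∪ Y| ≤ l` then `X ∪ Y ∈ A ∩ B` by upward closure), so there are at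
most `|min A| · |min B| ≤ ((r-1)^l)^2` of them (Cor. 3.3). [cite: AlonBoppana1987, Lemma 3.13] -/
theorem card_errPos_le {r l s : ℕ} (hr : 2 ≤ r) (hs : s = l + 1) {A B : Finset (Finset (Fin m))}
    (hA : IsClosedFamily r l A) (hB : IsClosedFamily r l B) :
    #(errPos s A B) ≤ ((r - 1) ^ l) ^ 2 := by
  classical
  -- if one family contains `∅` there is no error at all
  by_cases h0A : ∅ ∈ A
  · have hAB : A ∩ B = B := by
      rw [hA.eq_smallSets_of_empty_mem h0A]
      exact inter_eq_right.2 hB.subset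
    rw [errPos, filter_false_of_mem, card_empty]
    · exact Nat.zero_le _
    · intro Z _ h
      rw [hAB] at h
      exact h.2.2 h.2.1
  by_cases h0B : ∅ ∈ B
  · have hAB : A ∩ B = A := by
      rw [hB.eq_smallSets_of_empty_mem h0B]
      exact inter_eq_left.2 hA.subset
    rw [errPos, filter_false_of_mem, card_empty]
    · exact Nat.zero_le _
    · intro Z _ h
      rw [hAB] at h
      exact h.2.2 h.1
  -- otherwise every error is `X ∪ Y` for minimal members
  have hcover : errPos s A B ⊆ (minimals A ×ˢ minimals B).image fun p => p.1 ∪ p.2 := by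
    intro Z hZ
    obtain ⟨hZs, ⟨X, hXA, hXP⟩, ⟨Y, hYB, hYP⟩, hnot⟩ := mem_errPos.1 hZ
    have hX1 : #X ≠ 1 := (mem_smallSets.1 (hA.subset hXA)).2
    have hY1 : #Y ≠ 1 := (mem_smallSets.1 (hB.subset hYB)).2
    rw [cliquePresent_cliqueVec_iff hX1] at hXP
    rw [cliquePresent_cliqueVec_iff hY1] at hYP
    obtain ⟨X', hX', hX'X⟩ := exists_minimal_subset hXA
    obtain ⟨Y', hY', hY'Y⟩ := exists_minimal_subset hYB
    have hX'A : X' ∈ A := minimals_subset A hX'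
    have hY'B : Y' ∈ B := minimals_subset B hY'
    have hX'1 : #X' ≠ 1 := (mem_smallSets.1 (hA.subset hX'A)).2
    have hX'0 : X' ≠ ∅ := fun h => h0A (h ▸ hX'A)
    have hX'2 : 2 ≤ #X' := by
      have := card_ne_zero.2 (nonempty_iff_ne_empty.2 hX'0)
      omega
    have hUZ : X' ∪ Y' ⊆ Z := union_subset (hX'X.trans hXP) (hY'Y.trans hYP)
    have hU2 : 2 ≤ #(X' ∪ Y') := hX'2.trans (card_le_card subset_union_left)
    have heq : X' ∪ Y' = Z := by
      by_contra hne
      have hlt : #(X' ∪ Y') < #Z := card_lt_card ⟨hUZ, fun h => hne (Subset.antisymm hUZ h)⟩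
      have hsmall : X' ∪ Y' ∈ smallSets (Fin m) l := mem_smallSets.2 ⟨by omega, by omega⟩
      have hUA : X' ∪ Y' ∈ A := hA.mem_of_subset hX'A subset_union_left hsmall
      have hUB : X' ∪ Y' ∈ B := hB.mem_of_subset hY'B subset_union_right hsmall
      exact hnot ⟨X' ∪ Y', mem_inter.2 ⟨hUA, hUB⟩,
        (cliquePresent_cliqueVec_iff (by omega)).2 hUZ⟩
    exact mem_image.2 ⟨(X', Y'), mem_product.2 ⟨hX', hY'⟩, heq⟩
  calc #(errPos s A B) ≤ #((minimals A ×ˢ minimals B).image fun p => p.1 ∪ p.2) := card_le_card hcover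
    _ ≤ #(minimals A ×ˢ minimals B) := card_image_le
    _ = #(minimals A) * #(minimals B) := card_product _ _
    _ ≤ (r - 1) ^ l * (r - 1) ^ l :=
        Nat.mul_le_mul (hA.card_minimals_le hr) (hB.card_minimals_le hr)
    _ = ((r - 1) ^ l) ^ 2 := (sq _).symm

/-- **Wrongly accepted colourings of a closure** — the variant of Alon–Boppana 1987, Lemma 3.7
in which the number of closure steps is bounded by `|𝒱(l) ∖ C| ≤ |𝒱(l)|` (the "weaker bound
sufficient for all our purposes" of §3.2, remark before Lemma 3.4) instead of the printed
`2 r^l` of Lemma 3.5: for `C ⊆ 𝒱(l)`,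
`#{O : ⌈C*⌉(G(O)) ∧ ¬⌈C⌉(G(O))} · (g^l)^r ≤ |𝒱(l) ∖ C| · (g^l - g(g-1)⋯(g-l+1))^r · g^m`,
i.e. `Pr[G(O) ∈ [C*] - [C]] ≤ |𝒱(l) ∖ C| · (1 - g(g-1)⋯(g-l+1)/g^l)^r`. Proof: if `C` is not
closed, some implied `U` has `canon U ∉ C`; adding it costs at most the colourings that
properly colour `U` but none of the implying sets (Lemma 3.6), and does not change the closure.
[cite: AlonBoppana1987, Lemma 3.7] -/
theorem card_errNeg_mul_le {g r l : ℕ} {C : Finset (Finset (Fin m))} (hC : C ⊆ smallSets (Fin m) l) :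
    #(errNeg g r l C) * (g ^ l) ^ r ≤
      #(smallSets (Fin m) l \ C) * ((g ^ l - g.descFactorial l) ^ r * g ^ m) := by
  classical
  suffices h : ∀ (n : ℕ) (C : Finset (Finset (Fin m))), C ⊆ smallSets (Fin m) l →
      #(smallSets (Fin m) l \ C) = n →
      #(errNeg g r l C) * (g ^ l) ^ r ≤ n * ((g ^ l - g.descFactorial l) ^ r * g ^ m) by
    exact h _ C hC rfl
  intro n
  induction n with
  | zero =>
    intro C hC hn
    have hCeq : C = smallSets (Fin m) l :=
      Subset.antisymm hC fun W hW => by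
        by_contra hWC
        exact card_ne_zero.2 ⟨W, mem_sdiff.2 ⟨hW, hWC⟩⟩ hn
    have hempty : errNeg g r l C = ∅ := by
      refine filter_false_of_mem fun O _ h => h.2 ?_
      have h1 := h.1
      rwa [closure_eq_of_isClosedFamily (hCeq ▸ isClosedFamily_smallSets r l)] at h1
    simp [hempty]
  | succ n ih =>
    intro C hC hn
    by_cases hcl : IsClosedFamily r l C
    · have hempty : errNeg g r l C = ∅ := by
        refine filter_false_of_mem fun O _ h => h.2 ?_
        have h1 := h.1
        rwa [closure_eq_of_isClosedFamily hcl] at h1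
      simp [hempty]
    -- an implied set missing from `C`
    have hex : ∃ U : Finset (Fin m), #U ≤ l ∧ Implies r C U ∧ canon U ∉ C := by
      by_contra h
      push Not at h
      exact hcl ⟨hC, h⟩
    obtain ⟨U, hUl, hImp, hUC⟩ := hex
    obtain ⟨W, hW, hWU⟩ := hImp
    have hImp' : Implies r C U := ⟨W, hW, hWU⟩
    have hcanon : canon U ∈ closure r l C :=
      (isClosedFamily_closure r l C).mem_of_implies U hUl (hImp'.mono (subset_closure hC))
    set C' := insert (canon U) C with hC'def
    have hC' : C' ⊆ smallSets (Fin m) l := insert_subset (canon_mem_smallSets hUl) hC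
    have hcleq : closure r l C' = closure r l C :=
      closure_eq_of_subset_of_subset_closure (subset_insert _ _) (insert_subset hcanon (subset_closure hC))
    have hn' : #(smallSets (Fin m) l \ C') = n := by
      rw [hC'def, sdiff_insert, card_erase_of_mem (mem_sdiff.2 ⟨canon_mem_smallSets hUl, hUC⟩), hn]
      rfl
    have ih' := ih C' hC' hn'
    -- the new errors
    have hcover : errNeg g r l C ⊆ errNeg g r l C' ∪ badColorings g U (List.ofFn W) := by
      intro O hO
      obtain ⟨hacc, hnacc⟩ := mem_errNeg.1 hO
      by_cases hC'acc : Accepts C' (colorVec O)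
      · refine mem_union_right _ (mem_badColorings.2 ⟨?_, ?_⟩)
        · obtain ⟨W₀, hW₀, hP⟩ := hC'acc
          rcases mem_insert.1 hW₀ with rfl | hW₀C
          · rw [cliquePresent_colorVec_iff] at hP
            by_cases hU2 : 2 ≤ #U
            · rwa [canon_eq_self hU2] at hP
            · intro a ha b hb _
              exact card_le_one.1 (by omega) a ha b hb
          · exact absurd ⟨W₀, hW₀C, hP⟩ hnacc
        · intro W' hW'
          obtain ⟨i, rfl⟩ := (List.mem_ofFn' W W').1 hW'
          rw [← cliquePresent_colorVec_iff]
          exact fun hP => hnacc ⟨W i, hW i, hP⟩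
      · exact mem_union_left _ (mem_errNeg.2 ⟨hcleq ▸ hacc, hC'acc⟩)
    have hbad := card_badColorings_ofFn_mul_le (g := g) U W hWU fun i => (mem_smallSets.1 (hC (hW i))).1
    rw [Fintype.card_fin] at hbad
    calc #(errNeg g r l C) * (g ^ l) ^ r
        ≤ (#(errNeg g r l C') + #(badColorings g U (List.ofFn W))) * (g ^ l) ^ r :=
          Nat.mul_le_mul_right _ ((card_le_card hcover).trans (card_union_le _ _))
      _ = #(errNeg g r l C') * (g ^ l) ^ r + #(badColorings g U (List.ofFn W)) * (g ^ l) ^ r := by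
          ring
      _ ≤ n * ((g ^ l - g.descFactorial l) ^ r * g ^ m) + (g ^ l - g.descFactorial l) ^ r * g ^ m :=
          Nat.add_le_add ih' hbad
      _ = (n + 1) * ((g ^ l - g.descFactorial l) ^ r * g ^ m) := by ring

/-! ### Razborov's theorem along a straight-line program (Alon–Boppana 1987, Thm. 2.1) -/

/-- **Approximating a whole monotone program** (Alon–Boppana 1987, proof of Thm. 2.1, run in the
lattice `K(m, r, l)`): along a well-formed program over `{∧₂, ∨₂}` on the edges of `K_m`, every
wire receives a closed family satisfying `RApprox` relative to global bad sets, with at most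
`((r-1)^l)^2` lost `s`-cliques per gate (`card_errPos_le`) and at most
`|𝒱(l)| (1 - g(g-1)⋯(g-l+1)/g^l)^r g^m` wrongly accepted colourings per gate
(`card_errNeg_mul_le`). [cite: AlonBoppana1987, Thm. 2.1] -/
theorem exists_rApprox_gates {r l s g : ℕ} (hr : 2 ≤ r) (hl : 2 ≤ l) (hs : s = l + 1) :
    ∀ gs : List (Gate (KEdge m)), WF gs → (∀ gt ∈ gs, gt.fn ∈ monotoneBasis) →
      ∃ (ap : KEdge m ⊕ ℕ → Finset (Finset (Fin m))) (BadZ : Finset (Finset (Fin m)))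
        (BadO : Finset (Fin m → Fin g)),
        #BadZ ≤ gs.length * ((r - 1) ^ l) ^ 2 ∧
        #BadO * (g ^ l) ^ r ≤ gs.length * (#(smallSets (Fin m) l) * ((g ^ l - g.descFactorial l) ^ r * g ^ m)) ∧
        ∀ w : KEdge m ⊕ ℕ, OutOK gs.length w →
          RApprox r l s g BadZ BadO (ap w) (fun x => wireOf x (vals gs x) w) := by
  intro gs
  induction gs using List.reverseRecOn with
  | nil =>
    intro _ _
    refine ⟨fun w => match w with
      | .inl e => inputFamily l e
      | .inr _ => ∅, ∅, ∅, by simp, by simp, fun w hw => ?_⟩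
    rcases w with e | n
    · exact RApprox.input hr hl e
    · exact absurd (hw n rfl) (by simp)
  | append_singleton gs gt ih =>
    intro hwf hB
    obtain ⟨ap, BadZ, BadO, hcZ, hcO, hinv⟩ :=
      ih hwf.of_append_left fun g' hg' => hB g' (List.mem_append_left _ hg')
    have hgOK : GateOK gs.length gt := hwf.gateOK_mid (post := [])
    have hgB : gt.fn ∈ monotoneBasis := hB gt (by simp)
    set P := ((r - 1) ^ l) ^ 2 with hP
    set Q := #(smallSets (Fin m) l) * ((g ^ l - g.descFactorial l) ^ r * g ^ m) with hQ
    -- old wires keep their values and invariants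
    have hold : ∀ (BadZ' : Finset (Finset (Fin m))) (BadO' : Finset (Fin m → Fin g)),
        BadZ ⊆ BadZ' → BadO ⊆ BadO' → ∀ w : KEdge m ⊕ ℕ, OutOK gs.length w →
        RApprox r l s g BadZ' BadO' (ap w) (fun x => wireOf x (vals (gs ++ [gt]) x) w) :=
      fun BadZ' BadO' hZ hO w hw =>
        ((hinv w hw).mono hZ hO).congr fun x => (wireOf_vals_append gs [gt] x w hw).symm
    -- the value of the new gate
    have hnew : ∀ x, wireOf x (vals (gs ++ [gt]) x) (.inr gs.length) =
        gt.op (fun a => wireOf x (vals gs x) (gt.args a)) := fun x => by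
      rw [wireOf_inr, show gs ++ [gt] = gs ++ gt :: [] from rfl, getD_vals_append_cons]
    -- how to assemble the conclusion from an approximator of the new gate
    have assemble : ∀ (BadZ' : Finset (Finset (Fin m))) (BadO' : Finset (Fin m → Fin g))
        (Fn : Finset (Finset (Fin m))),
        BadZ ⊆ BadZ' → BadO ⊆ BadO' → #BadZ' ≤ (gs ++ [gt]).length * P →
        #BadO' * (g ^ l) ^ r ≤ (gs ++ [gt]).length * Q →
        RApprox r l s g BadZ' BadO' Fn (fun x => wireOf x (vals (gs ++ [gt]) x) (.inr gs.length)) →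
        ∃ (ap : KEdge m ⊕ ℕ → Finset (Finset (Fin m))) (BadZ : Finset (Finset (Fin m)))
          (BadO : Finset (Fin m → Fin g)),
          #BadZ ≤ (gs ++ [gt]).length * P ∧ #BadO * (g ^ l) ^ r ≤ (gs ++ [gt]).length * Q ∧
          ∀ w : KEdge m ⊕ ℕ, OutOK (gs ++ [gt]).length w →
            RApprox r l s g BadZ BadO (ap w) (fun x => wireOf x (vals (gs ++ [gt]) x) w) := by
      intro BadZ' BadO' Fn hZZ' hOO' hcZ' hcO' hnewinv
      refine ⟨fun w => if w = .inr gs.length then Fn else ap w, BadZ', BadO', hcZ', hcO',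
        fun w hw => ?_⟩
      by_cases hwn : w = .inr gs.length
      · subst hwn
        simpa using hnewinv
      · dsimp only
        rw [if_neg hwn]
        refine hold BadZ' BadO' hZZ' hOO' w fun n hn => ?_
        have h1 := hw n hn
        simp only [List.length_append, List.length_singleton] at h1
        have h2 : n ≠ gs.length := fun h => hwn (hn.trans (by rw [h]))
        omega
    have hlen : (gs ++ [gt]).length = gs.length + 1 := by simp
    simp only [monotoneBasis, Set.mem_insert_iff, Set.mem_singleton_iff] at hgB
    rcases hgB with hc | hc
    · -- AND gate
      obtain ⟨u, v, rfl⟩ := exists_eq_andGate_of_fn_eq hc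
      have hu : OutOK gs.length u := fun n hn => hgOK (0 : Fin 2) n hn
      have hv : OutOK gs.length v := fun n hn => hgOK (1 : Fin 2) n hn
      have hnewinv := RApprox.and_gate (hinv u hu) (hinv v hv)
      have hcZ' : #(BadZ ∪ errPos s (ap u) (ap v)) ≤ (gs.length + 1) * P :=
        calc #(BadZ ∪ errPos s (ap u) (ap v)) ≤ #BadZ + #(errPos s (ap u) (ap v)) :=
              card_union_le _ _
          _ ≤ gs.length * P + P :=
              Nat.add_le_add hcZ (card_errPos_le hr hs (hinv u hu).closed (hinv v hv).closed)
          _ = (gs.length + 1) * P := by ring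
      refine assemble (BadZ ∪ errPos s (ap u) (ap v)) BadO _ subset_union_left Subset.rfl
        (by rw [hlen]; exact hcZ') (hcO.trans (Nat.mul_le_mul_right _ (by simp)))
        (hnewinv.congr fun x => ?_)
      rw [hnew, andGate_op]
    · -- OR gate
      obtain ⟨u, v, rfl⟩ := exists_eq_orGate_of_fn_eq hc
      have hu : OutOK gs.length u := fun n hn => hgOK (0 : Fin 2) n hn
      have hv : OutOK gs.length v := fun n hn => hgOK (1 : Fin 2) n hn
      have hnewinv := RApprox.or_gate (hinv u hu) (hinv v hv)
      have hsub : ap u ∪ ap v ⊆ smallSets (Fin m) l :=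
        union_subset (hinv u hu).closed.subset (hinv v hv).closed.subset
      have herr : #(errNeg g r l (ap u ∪ ap v)) * (g ^ l) ^ r ≤ Q :=
        (card_errNeg_mul_le hsub).trans (Nat.mul_le_mul_right _ (card_le_card sdiff_subset))
      have hcO' : #(BadO ∪ errNeg g r l (ap u ∪ ap v)) * (g ^ l) ^ r ≤ (gs.length + 1) * Q :=
        calc #(BadO ∪ errNeg g r l (ap u ∪ ap v)) * (g ^ l) ^ r
            ≤ (#BadO + #(errNeg g r l (ap u ∪ ap v))) * (g ^ l) ^ r :=
              Nat.mul_le_mul_right _ (card_union_le _ _)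
          _ = #BadO * (g ^ l) ^ r + #(errNeg g r l (ap u ∪ ap v)) * (g ^ l) ^ r := by ring
          _ ≤ gs.length * Q + Q := Nat.add_le_add hcO herr
          _ = (gs.length + 1) * Q := by ring
      refine assemble BadZ (BadO ∪ errNeg g r l (ap u ∪ ap v)) _ Subset.rfl subset_union_left
        (hcZ.trans (Nat.mul_le_mul_right _ (by simp))) (by rw [hlen]; exact hcO')
        (hnewinv.congr fun x => ?_)
      rw [hnew, orGate_op]

/-- **Razborov's theorem for CLIQUE-type circuits** (Alon–Boppana 1987, Thm. 2.1 in the lattice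
`K(m, r, l)` of §3.1, equations (2.1)–(2.2) on the test graphs): a circuit of size `t` over
`{∧₂, ∨₂}` computing `f` has a closed family `F` such that every `s`-clique accepted by `f` is
accepted by `⌈F⌉` up to at most `t · ((r-1)^l)^2` lost cliques, and every colouring accepted by
`⌈F⌉` is accepted by `f` up to a set `BadO` of colourings with
`#BadO · (g^l)^r ≤ t · |𝒱(l)| · (g^l - g(g-1)⋯(g-l+1))^r · g^m`. [cite: AlonBoppana1987, Thm. 2.1] -/
theorem exists_rApprox_circuit {r l s g : ℕ} (hr : 2 ≤ r) (hl : 2 ≤ l) (hs : s = l + 1)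
    (C : Circuit (KEdge m)) (hC : C.IsOver monotoneBasis) {f : (KEdge m → Bool) → Bool}
    (hf : C.Computes f) :
    ∃ (F : Finset (Finset (Fin m))) (BadZ : Finset (Finset (Fin m))) (BadO : Finset (Fin m → Fin g)),
      IsClosedFamily r l F ∧ #BadZ ≤ C.size * ((r - 1) ^ l) ^ 2 ∧
      #BadO * (g ^ l) ^ r ≤ C.size * (#(smallSets (Fin m) l) * ((g ^ l - g.descFactorial l) ^ r * g ^ m)) ∧
      (∀ Z : Finset (Fin m), #Z = s → f (cliqueVec Z) = true → Accepts F (cliqueVec Z) ∨ Z ∈ BadZ) ∧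
      (∀ O : Fin m → Fin g, Accepts F (colorVec O) → f (colorVec O) = true ∨ O ∈ BadO) := by
  obtain ⟨ap, BadZ, BadO, hcZ, hcO, hinv⟩ :=
    exists_rApprox_gates (g := g) hr hl hs C.gates (wf_gates C) hC
  have h := hinv C.output C.wf_output
  refine ⟨ap C.output, BadZ, BadO, h.closed, hcZ, hcO, fun Z hZs hZ => h.pos Z hZs ?_,
    fun O hO => ?_⟩
  · rw [← hZ, ← hf, circuit_eval]
  · have := h.neg O hO
    rwa [← circuit_eval, hf] at this

/-! ### The dichotomy (Alon–Boppana 1987, proof of Lemma 3.14) -/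

/-- **Razborov–Alon–Boppana dichotomy for small cliques** (Alon–Boppana 1987, proof of
Lemma 3.14 with `l = s - 1`, constants not optimised). Let `r, l ≥ 2`, `s = l + 1`, and let a
circuit of size `t` over `{∧₂, ∨₂}` compute a function `f` on the edges of `K_m` accepting every
`s`-clique and rejecting the complete multipartite graph of every `g`-colouring. Then either
(Case 2, the approximator contains `∅` and accepts everything)
`g^m · (g^l)^r ≤ t · |𝒱(l)| · (g^l - g(g-1)⋯(g-l+1))^r · g^m`, or (Case 1) every `s`-clique is
lost or contains a minimal member of the approximator, whence
`(m choose s) ≤ t · ((r-1)^l)^2 + Σ_{k=2}^{l} (r-1)^k · (m-k choose s-k)` (Cor. 3.3).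
[cite: AlonBoppana1987, Lemma 3.14] -/
theorem razborov_dichotomy {r l s g : ℕ} (hr : 2 ≤ r) (hl : 2 ≤ l) (hs : s = l + 1)
    (C : Circuit (KEdge m)) (hC : C.IsOver monotoneBasis) {f : (KEdge m → Bool) → Bool}
    (hf : C.Computes f) (hpos : ∀ Z : Finset (Fin m), #Z = s → f (cliqueVec Z) = true)
    (hneg : ∀ O : Fin m → Fin g, f (colorVec O) = false) :
    g ^ m * (g ^ l) ^ r ≤ C.size * (#(smallSets (Fin m) l) * ((g ^ l - g.descFactorial l) ^ r * g ^ m)) ∨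
    m.choose s ≤ C.size * ((r - 1) ^ l) ^ 2 + ∑ k ∈ Icc 2 l, (r - 1) ^ k * (m - k).choose (s - k) := by
  classical
  obtain ⟨F, BadZ, BadO, hF, hcZ, hcO, hposF, hnegF⟩ := exists_rApprox_circuit (g := g) hr hl hs C hC hf
  by_cases h0 : ∅ ∈ F
  · -- Case 2: the approximator accepts every colouring, so all colourings are bad
    left
    have hall : (univ : Finset (Fin m → Fin g)) ⊆ BadO := fun O _ => by
      rcases hnegF O (accepts_of_empty_mem h0 _) with h | h
      · rw [hneg O] at h
        exact absurd h Bool.false_ne_true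
      · exact h
    have hcard : g ^ m ≤ #BadO := by
      have := card_le_card hall
      rwa [card_univ, Fintype.card_fun, Fintype.card_fin, Fintype.card_fin] at this
    exact (Nat.mul_le_mul_right _ hcard).trans hcO
  · -- Case 1: every `s`-clique is lost or contains a minimal member of `F`
    right
    have hcover : powersetCard s (univ : Finset (Fin m)) ⊆
        BadZ ∪ (minimals F).biUnion fun M => (powersetCard s univ).filter fun Z => M ⊆ Z := by
      intro Z hZ
      have hZs : #Z = s := (mem_powersetCard.1 hZ).2
      rcases hposF Z hZs (hpos Z hZs) with ⟨W, hW, hP⟩ | h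
      · rw [cliquePresent_cliqueVec_iff (mem_smallSets.1 (hF.subset hW)).2] at hP
        obtain ⟨M, hM, hMW⟩ := exists_minimal_subset hW
        exact mem_union_right _ (mem_biUnion.2 ⟨M, hM, mem_filter.2 ⟨hZ, hMW.trans hP⟩⟩)
      · exact mem_union_left _ h
    -- minimal members have between `2` and `l` elements
    have hMcard : ∀ M ∈ minimals F, #M ∈ Icc 2 l := by
      intro M hM
      have hMF := minimals_subset F hM
      have h := mem_smallSets.1 (hF.subset hMF)
      have hM0 : #M ≠ 0 := fun hc => h0 (card_eq_zero.1 hc ▸ hMF)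
      exact mem_Icc.2 ⟨by omega, h.1⟩
    calc m.choose s = #(powersetCard s (univ : Finset (Fin m))) := by
          rw [card_powersetCard, card_univ, Fintype.card_fin]
      _ ≤ #BadZ + #((minimals F).biUnion fun M => (powersetCard s univ).filter fun Z => M ⊆ Z) :=
          (card_le_card hcover).trans (card_union_le _ _)
      _ ≤ C.size * ((r - 1) ^ l) ^ 2 + ∑ M ∈ minimals F, (m - #M).choose (s - #M) := by
          refine Nat.add_le_add hcZ (card_biUnion_le.trans (sum_le_sum fun M hM => ?_))
          have hMs : #M ≤ s := by have := (mem_Icc.1 (hMcard M hM)).2; omega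
          have h := card_filter_supset_powersetCard_le (univ : Finset (Fin m)) M hMs
          rwa [card_univ, Fintype.card_fin] at h
      _ = C.size * ((r - 1) ^ l) ^ 2 +
            ∑ k ∈ Icc 2 l, ∑ M ∈ (minimals F).filter (fun M => #M = k), (m - #M).choose (s - #M) := by
          rw [sum_fiberwise_of_maps_to hMcard]
      _ = C.size * ((r - 1) ^ l) ^ 2 +
            ∑ k ∈ Icc 2 l, #((minimals F).filter fun M => #M = k) * (m - k).choose (s - k) := by
          congr 1
          refine sum_congr rfl fun k _ => ?_
          rw [sum_congr rfl fun M hM => by rw [(mem_filter.1 hM).2], sum_const, smul_eq_mul]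
      _ ≤ C.size * ((r - 1) ^ l) ^ 2 + ∑ k ∈ Icc 2 l, (r - 1) ^ k * (m - k).choose (s - k) := by
          refine Nat.add_le_add_left (sum_le_sum fun k _ => Nat.mul_le_mul_right _ ?_) _
          calc #((minimals F).filter fun M => #M = k)
              ≤ #((minimals F).filter fun M => #M ≤ k) :=
                card_le_card (monotone_filter_right _ fun M _ (h : #M = k) => h.le)
            _ ≤ (r - 1) ^ k := hF.card_minimals_filter_le hr k

end Literature.Computability.Complexity
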